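import Literature.NumberTheory.EllipticCurves.LatticeInclusionRigidityProofs
import Literature.NumberTheory.EllipticCurves.RealLatticePeriod

/-!
# `XMapKernel`, line `isogeny-orbit-collapse` — stub **R-b0**: `Aut(ℂ)`-rigidity of lattice multipliers

Support file for the crux `IsogenyCertificates.XMapKernel` (stmt-KontsevichZagierPeriods-10663),
line `isogeny-orbit-collapse`, stub `stub_multiplierRigidity` (R-b0).

**Statement.** Let `Λ`, `Λ'` be lattices (Mathlib `PeriodPair`s) whose invariants `g₂, g₃` and
`g₂', g₃'` are rational, let `γ ≠ 0` with `γΛ ⊆ Λ'`, and let `σ` be any field automorphism of `ℂ`.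
Then `σ(γ)Λ ⊆ Λ'`.

**Proof.** `γΛ ⊆ Λ'` says `Λ ⊆ γ⁻¹Λ' =: Λ₂` (the tree's homothetic pair `PeriodPair.mulLeft`,
`mem_mulLeft_lattice`). Apply the transport of lattice inclusions along `σ`
(`PeriodPair.lattice_le_of_le_map`, the `Aut(ℂ)`-transport of the algebraic certificate of an
inclusion, Cox *Primes of the form x² + ny²* §10.C) with `L₁ := Λ`, `L₂ := γ⁻¹Λ'`, `M₁ := Λ`
(its invariants are rational, hence fixed by `σ`: `map_ratCast`) and `M₂ := (σγ)⁻¹Λ'`, whose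
invariants `(σγ)⁴ g₂'`, `(σγ)⁶ g₃'` (`g₂_mulLeft`, `g₃_mulLeft`) are the `σ`-images of the
invariants `γ⁴ g₂'`, `γ⁶ g₃'` of `γ⁻¹Λ'` because `g₂', g₃' ∈ ℚ`. The conclusion `Λ ⊆ (σγ)⁻¹Λ'` is
`σ(γ)Λ ⊆ Λ'`. No new definitions; no named facts are used.

References: Cox, *Primes of the form x² + ny²* (2013), §10.C (proof of Thm. 10.23);
Silverman, *The Arithmetic of Elliptic Curves* (2009), Cor. VI.5.1.1.
-/

noncomputable section

namespace Summit.KontsevichZagierPeriods.IsogenyCertificates.XMapKernelStubs.MultiplierRigidity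

/-- **Invariants of `(σc)⁻¹Λ'` versus `σ` of the invariants of `c⁻¹Λ'`, weight `4`.** If `g₂(Λ')`
is rational then `g₂((σ c)⁻¹Λ') = σ (g₂(c⁻¹Λ'))` (`g₂_mulLeft`, `map_ratCast`). [folklore] -/
theorem g₂_mulLeft_inv_map (σ : ℂ ≃+* ℂ) (L' : PeriodPair) {c : ℂ} (hc : c⁻¹ ≠ 0)
    (hσc : (σ c)⁻¹ ≠ 0) (h₂ : ∃ q : ℚ, (q : ℂ) = L'.g₂) :
    (L'.mulLeft (σ c)⁻¹ hσc).g₂ = σ (L'.mulLeft c⁻¹ hc).g₂ := by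
  obtain ⟨q, hq⟩ := h₂
  rw [PeriodPair.g₂_mulLeft, PeriodPair.g₂_mulLeft, map_mul, map_inv₀, map_pow, map_inv₀, ← hq,
    map_ratCast]

/-- **Invariants of `(σc)⁻¹Λ'` versus `σ` of the invariants of `c⁻¹Λ'`, weight `6`.** If `g₃(Λ')`
is rational then `g₃((σ c)⁻¹Λ') = σ (g₃(c⁻¹Λ'))` (`g₃_mulLeft`, `map_ratCast`). [folklore] -/
theorem g₃_mulLeft_inv_map (σ : ℂ ≃+* ℂ) (L' : PeriodPair) {c : ℂ} (hc : c⁻¹ ≠ 0)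
    (hσc : (σ c)⁻¹ ≠ 0) (h₃ : ∃ q : ℚ, (q : ℂ) = L'.g₃) :
    (L'.mulLeft (σ c)⁻¹ hσc).g₃ = σ (L'.mulLeft c⁻¹ hc).g₃ := by
  obtain ⟨q, hq⟩ := h₃
  rw [PeriodPair.g₃_mulLeft, PeriodPair.g₃_mulLeft, map_mul, map_inv₀, map_pow, map_inv₀, ← hq,
    map_ratCast]

/-- **R-b0 — `Aut(ℂ)`-rigidity of lattice multipliers.** If `Λ, Λ'` are lattices with rational
invariants `g₂, g₃`, `γ ≠ 0` and `γΛ ⊆ Λ'`, then `σ(γ)Λ ⊆ Λ'` for every field automorphism `σ` of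
`ℂ`: rewrite `γΛ ⊆ Λ'` as `Λ ⊆ γ⁻¹Λ'` (`PeriodPair.mulLeft`, `mem_mulLeft_lattice`) and transport
it along `σ` by `PeriodPair.lattice_le_of_le_map` to `Λ ⊆ (σγ)⁻¹Λ'`, the invariants of `Λ` being
`σ`-fixed (`map_ratCast`) and those of `(σγ)⁻¹Λ'` being the `σ`-images of those of `γ⁻¹Λ'`
(`g₂_mulLeft_inv_map`, `g₃_mulLeft_inv_map`). [cite: Cox2013, §10.C] -/
theorem stub_multiplierRigidity : ∀ (L L' : PeriodPair) (γ : ℂ) (σ : ℂ ≃+* ℂ), (∃ q : ℚ, (q : ℂ) = L.g₂) → (∃ q : ℚ, (q : ℂ) = L.g₃) → (∃ q : ℚ, (q : ℂ) = L'.g₂) → (∃ q : ℚ, (q : ℂ) = L'.g₃) → γ ≠ 0 → (∀ l ∈ L.lattice, γ * l ∈ L'.lattice) → ∀ l ∈ L.lattice, σ γ * l ∈ L'.lattice := by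
  intro L L' γ σ h₂ h₃ h₂' h₃' hγ hmul l hl
  have hγi : γ⁻¹ ≠ 0 := inv_ne_zero hγ
  have hσγ : σ γ ≠ 0 := (map_ne_zero σ).mpr hγ
  have hσγi : (σ γ)⁻¹ ≠ 0 := inv_ne_zero hσγ
  -- `γΛ ⊆ Λ'` as `Λ ⊆ γ⁻¹Λ'`
  have hle : L.lattice ≤ (L'.mulLeft γ⁻¹ hγi).lattice := by
    intro x hx
    rw [PeriodPair.mem_mulLeft_lattice, inv_inv]
    exact hmul x hx
  -- the invariants of `Λ` are fixed by `σ`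
  have hL₂ : L.g₂ = σ L.g₂ := by
    obtain ⟨q, hq⟩ := h₂
    rw [← hq, map_ratCast]
  have hL₃ : L.g₃ = σ L.g₃ := by
    obtain ⟨q, hq⟩ := h₃
    rw [← hq, map_ratCast]
  -- transport along `σ`
  have hle' : L.lattice ≤ (L'.mulLeft (σ γ)⁻¹ hσγi).lattice :=
    PeriodPair.lattice_le_of_le_map σ hle hL₂ hL₃ (g₂_mulLeft_inv_map σ L' hγi hσγi h₂')
      (g₃_mulLeft_inv_map σ L' hγi hσγi h₃')
  have hl' := hle' hl
  rwa [PeriodPair.mem_mulLeft_lattice, inv_inv] at hl'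

end Summit.KontsevichZagierPeriods.IsogenyCertificates.XMapKernelStubs.MultiplierRigidity
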